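import Summits.QuantumFields.YangMills.Theorems.LuscherReductionTwistedTraceScalingBOShellCoercive
import Summits.QuantumFields.YangMills.Theorems.LuscherReductionTwistedTraceScalingCovGradInjective
import HarnessLib

/-!
# (C5-α, L-c) STIFF SEPARATION, THE PROJECTION STEP: from `x' = x − D_uζ₀ + κ + Y` to `‖ζ₀‖∞ ≤ 2C_P(2τ + ‖Y‖)` and `‖x'‖² ≤ τ² + (‖x‖ + 4τ + 4‖Y‖)²`
# (lane A of S-BASE, crux `TwistedTraceScaling` stmt-QuantumFields-20203, C4-CORE, the (OD) pen; §4 (S6′) of `pub/ym-fleet/ym-luscher-20007-p1/Lines-stiff-separation.md`)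

Pure Hilbert-space algebra in `LinkSpace L` with the two orthogonal projections `P_c` (constant modes) and `P_Γ` (vacuum gauge modes `Γ = range ∇`): for balanced `x', x`
(`⟂ constModes`), a MEAN-ZERO gauge parameter `ζ₀`, a constant mode `κ` and an error `Y` with `x' = x − D_uζ₀ + κ + Y` (the link-space identity of `…BOStiffSepLink`):
* §1 bookkeeping: `‖v − P v‖ ≤ ‖v‖`, `P_c∇ξ = 0`, `P_c v = 0` for balanced `v` (`P_Γ∇ξ = ∇ξ` is `…CovGradInjective.proj_vacGrad`);
* §2 ★★ `stiffSep_proj_bounds` — (a) `‖P_Γ(D_uζ₀)‖ ≤ ‖P_Γx'‖ + ‖P_Γx‖ + ‖Y‖` (`P_Γκ = 0`); (b) `‖x' − P_Γx'‖ ≤ ‖x‖ + 2‖(D_u − ∇)ζ₀‖ + 2‖Y‖` (`P_c` kills `x, x'` and `∇ζ₀`, so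
  `κ = P_c(D_u−∇)ζ₀ − P_cY`; `∇ζ₀ − P_Γ∇ζ₀ = 0`);
* §3 ★★★ `stiffSep_radius_bound` — with the slice-injectivity constant (`‖ξ‖∞ ≤ C_P‖∇ξ‖` on mean-zero `ξ`, `12√(3|E|)τ_uC_P ≤ 1/2`, `|u⃗_k|∞ ≤ τ_u ≤ 1`;
  `…CovGradInjective.norm_le_of_proj_covGradL`, `norm_covGradL_sub_vacGrad_le`) and `‖P_Γx'‖, ‖P_Γx‖ ≤ τ`:  `‖ζ₀‖∞ ≤ 2C_P(2τ + ‖Y‖)` and `‖x'‖² ≤ τ² + (‖x‖ + 4τ + 4‖Y‖)²`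
  (Pythagoras for `P_Γ`).  This is the bootstrap engine of (SEP): fed with the a-priori parameter size it returns a sharper one; fed twice it bounds the radius of `x'`.
HONEST FRAMING: algebra for a stub of a child of the CONDITIONAL route R2b1; the (SEP) wrapper, the hOD assembly, (B-ST), C4-CORE OPEN; not infinite volume, not a gap, not Clay.
-/

set_option autoImplicit false

noncomputable section

open Real
open scoped BigOperators RealInnerProductSpace
open Literature.MathematicalPhysics.QuantumFieldTheory
open Literature.MathematicalPhysics.QuantumLattice

namespace Summit.QuantumFields.YangMills.Theorems.FemtoTransferGap.TwoLattice.ConstTube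

open Summit.QuantumFields.YangMills.Theorems.FemtoTransferGap
open Summit.QuantumFields.YangMills.Theorems.FemtoTransferGap.TwoLattice
open Summit.QuantumFields.YangMills.Theorems.FemtoTransferGap.TwoLattice.Stiff
open Summit.QuantumFields.YangMills.Theorems.FemtoTransferGap.TwoLattice.Toron
open Summit.QuantumFields.YangMills.Theorems.FemtoTransferGap.TwoLattice.Cov

variable {L : ℕ} [NeZero L]

/-! ## §1 Bookkeeping with the two projections -/

/-- `‖v − P_K v‖ ≤ ‖v‖` for an orthogonal projection. [folklore] -/
theorem norm_sub_starProjection_le (K : Submodule ℝ (LinkSpace L)) (v : LinkSpace L) : ‖v - K.starProjection v‖ ≤ ‖v‖ := by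
  rw [← Submodule.starProjection_orthogonal_val]; exact Submodule.norm_starProjection_apply_le _ _

/-- Pythagoras: `‖v‖² = ‖P_K v‖² + ‖v − P_K v‖²`. [folklore] -/
theorem norm_sq_eq_proj_add_sub (K : Submodule ℝ (LinkSpace L)) (v : LinkSpace L) : ‖v‖ ^ 2 = ‖K.starProjection v‖ ^ 2 + ‖v - K.starProjection v‖ ^ 2 := by
  rw [← Submodule.starProjection_orthogonal_val]; exact Submodule.norm_sq_eq_add_norm_sq_starProjection v K

/-- `P_c ∇ξ = 0` (constants `⟂ Γ`). [folklore] -/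
theorem starProjection_constModes_vacGrad (ξ : Site 3 L → Fin 3 → ℝ) : (constModes L).starProjection (vacGrad L ξ) = 0 := by
  rw [Submodule.starProjection_apply_eq_zero_iff, Submodule.mem_orthogonal]
  intro c hc
  exact inner_eq_zero_of_mem_constModes_of_mem_gaugeModes (L := L) hc (LinearMap.mem_range_self _ _)

/-- `P_c v = 0` for balanced `v`. [folklore] -/
theorem starProjection_constModes_eq_zero_of_balanced {v : LinkSpace L} (hv : ∀ c ∈ constModes L, ⟪c, v⟫ = 0) : (constModes L).starProjection v = 0 := by
  rw [Submodule.starProjection_apply_eq_zero_iff, Submodule.mem_orthogonal]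
  exact hv

/-! ## §2 ★★ The two projection bounds -/

/-- ★★ **PROJECTION BOUNDS.**  `x' = x − D_uζ₀ + κ + Y` with `x', x` balanced and `κ ∈ constModes`:
(a) `‖P_Γ(D_uζ₀)‖ ≤ ‖P_Γx'‖ + ‖P_Γx‖ + ‖Y‖`; (b) `‖x' − P_Γx'‖ ≤ ‖x‖ + 2‖(D_u − ∇)ζ₀‖ + 2‖Y‖`. [folklore] -/
theorem stiffSep_proj_bounds {u : GaugeConfig 3 1 SU2} {ζ₀ : Site 3 L → Fin 3 → ℝ} {X X' Y κ : LinkSpace L}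
    (hid : X' = X - covGradL L u ζ₀ + κ + Y) (hκ : κ ∈ constModes L) (hX : ∀ c ∈ constModes L, ⟪c, X⟫ = 0) (hX' : ∀ c ∈ constModes L, ⟪c, X'⟫ = 0) :
    ‖(gaugeModes L).starProjection (covGradL L u ζ₀)‖ ≤ ‖(gaugeModes L).starProjection X'‖ + ‖(gaugeModes L).starProjection X‖ + ‖Y‖ ∧
      ‖X' - (gaugeModes L).starProjection X'‖ ≤ ‖X‖ + 2 * ‖covGradL L u ζ₀ - vacGrad L ζ₀‖ + 2 * ‖Y‖ := by
  set PΓ := (gaugeModes L).starProjection with hPΓ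
  set Pc := (constModes L).starProjection with hPc
  set D := covGradL L u ζ₀ with hD
  set G := vacGrad L ζ₀ with hG
  have hPΓκ : PΓ κ = 0 := starProjection_gaugeModes_of_mem_constModes (L := L) hκ
  have hPΓG : PΓ G = G := proj_vacGrad L ζ₀
  have hPcG : Pc G = 0 := starProjection_constModes_vacGrad (L := L) ζ₀
  have hPcX : Pc X = 0 := starProjection_constModes_eq_zero_of_balanced hX
  have hPcX' : Pc X' = 0 := starProjection_constModes_eq_zero_of_balanced hX'
  have hPcκ : Pc κ = κ := Submodule.starProjection_eq_self_iff.mpr hκ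
  constructor
  · -- (a)
    have e : PΓ D = PΓ X - PΓ X' + PΓ Y := by
      have h := congrArg PΓ hid
      rw [map_add, map_add, map_sub, hPΓκ, add_zero] at h
      rw [h]; abel
    rw [e]
    calc ‖PΓ X - PΓ X' + PΓ Y‖ ≤ ‖PΓ X - PΓ X'‖ + ‖PΓ Y‖ := norm_add_le _ _
      _ ≤ ‖PΓ X‖ + ‖PΓ X'‖ + ‖Y‖ := add_le_add (norm_sub_le _ _) (Submodule.norm_starProjection_apply_le _ _)
      _ = _ := by ring
  · -- (b): first `κ = P_c(D − ∇) − P_c Y`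
    have hκeq : κ = Pc (D - G) - Pc Y := by
      have h := congrArg Pc hid
      rw [map_add, map_add, map_sub, hPcX', hPcX, hPcκ, zero_sub] at h
      rw [map_sub, hPcG, sub_zero]
      -- `0 = -Pc D + κ + Pc Y`
      -- `h : 0 = -Pc D + κ + Pc Y`
      have h2 : κ = Pc D - Pc Y := by
        have h3 : -Pc D + κ + Pc Y = 0 := h.symm
        calc κ = (-Pc D + κ + Pc Y) + (Pc D - Pc Y) := by abel
          _ = Pc D - Pc Y := by rw [h3, zero_add]
      exact h2
    have e : X' - PΓ X' = (X - PΓ X) - ((D - G) - PΓ (D - G)) + κ + (Y - PΓ Y) := by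
      have h1 : PΓ X' = PΓ X - PΓ D + PΓ Y := by
        have h := congrArg PΓ hid
        rw [map_add, map_add, map_sub, hPΓκ, add_zero] at h; exact h
      rw [h1, hid, map_sub, hPΓG]; abel
    rw [e]
    have h1 : ‖X - PΓ X‖ ≤ ‖X‖ := norm_sub_starProjection_le _ _
    have h2 : ‖(D - G) - PΓ (D - G)‖ ≤ ‖D - G‖ := norm_sub_starProjection_le _ _
    have h3 : ‖κ‖ ≤ ‖D - G‖ + ‖Y‖ := by
      rw [hκeq]
      exact (norm_sub_le _ _).trans (add_le_add (Submodule.norm_starProjection_apply_le _ _) (Submodule.norm_starProjection_apply_le _ _))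
    have h4 : ‖Y - PΓ Y‖ ≤ ‖Y‖ := norm_sub_starProjection_le _ _
    calc ‖(X - PΓ X) - ((D - G) - PΓ (D - G)) + κ + (Y - PΓ Y)‖
        ≤ ‖(X - PΓ X) - ((D - G) - PΓ (D - G)) + κ‖ + ‖Y - PΓ Y‖ := norm_add_le _ _
      _ ≤ ‖(X - PΓ X) - ((D - G) - PΓ (D - G))‖ + ‖κ‖ + ‖Y - PΓ Y‖ := by gcongr; exact norm_add_le _ _
      _ ≤ ‖X - PΓ X‖ + ‖(D - G) - PΓ (D - G)‖ + ‖κ‖ + ‖Y - PΓ Y‖ := by gcongr; exact norm_sub_le _ _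
      _ ≤ ‖X‖ + ‖D - G‖ + (‖D - G‖ + ‖Y‖) + ‖Y‖ := by gcongr
      _ = _ := by ring

/-! ## §3 ★★★ The radius bound (the bootstrap engine) -/

/-- ★★★ **THE RADIUS BOUND.**  With the slice-injectivity data (`C_P > 0`, `‖ξ‖∞ ≤ C_P‖∇ξ‖` on mean-zero `ξ`, `12√(3|E|)τ_uC_P ≤ 1/2`, `|u⃗_k|∞ ≤ τ_u ≤ 1`), `ζ₀` mean zero,
`x' = x − D_uζ₀ + κ + Y` (balanced `x', x`, constant `κ`), `‖P_Γx'‖ ≤ τ`, `‖P_Γx‖ ≤ τ`: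
`‖ζ₀‖∞ ≤ 2C_P(2τ + ‖Y‖)` and `‖x'‖² ≤ τ² + (‖x‖ + 4τ + 4‖Y‖)²`. [folklore] -/
theorem stiffSep_radius_bound {C τu : ℝ} (hC : 0 < C) (hP : ∀ ξ : Site 3 L → Fin 3 → ℝ, ∑ y : Site 3 L, ξ y = 0 → ‖ξ‖ ≤ C * ‖vacGrad L ξ‖)
    (hτ1 : τu ≤ 1) (hsmall : 12 * Real.sqrt (3 * Fintype.card (Edge 3 L)) * τu * C ≤ 1 / 2)
    {u : GaugeConfig 3 1 SU2} (hu : ∀ (k : Fin 3) (c : Fin 3), |vecPart (u (0, k)) c| ≤ τu)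
    {ζ₀ : Site 3 L → Fin 3 → ℝ} (hζ₀ : ∑ y : Site 3 L, ζ₀ y = 0) {X X' Y κ : LinkSpace L}
    (hid : X' = X - covGradL L u ζ₀ + κ + Y) (hκ : κ ∈ constModes L) (hX : ∀ c ∈ constModes L, ⟪c, X⟫ = 0) (hX' : ∀ c ∈ constModes L, ⟪c, X'⟫ = 0)
    {τ : ℝ} (hτX' : ‖(gaugeModes L).starProjection X'‖ ≤ τ) (hτX : ‖(gaugeModes L).starProjection X‖ ≤ τ) :
    ‖ζ₀‖ ≤ 2 * C * (2 * τ + ‖Y‖) ∧ ‖X'‖ ^ 2 ≤ τ ^ 2 + (‖X‖ + 4 * τ + 4 * ‖Y‖) ^ 2 := by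
  obtain ⟨ha, hb⟩ := stiffSep_proj_bounds (L := L) hid hκ hX hX'
  have hτu0 : 0 ≤ τu := (abs_nonneg _).trans (hu 0 0)
  -- slice injectivity
  have hinj := norm_le_of_proj_covGradL (L := L) hC hP hτ1 hsmall u hu ζ₀ hζ₀
  have hζ : ‖ζ₀‖ ≤ 2 * C * (2 * τ + ‖Y‖) := by
    refine hinj.trans ?_
    have := mul_le_mul_of_nonneg_left (ha.trans (by linarith : _ ≤ 2 * τ + ‖Y‖)) (by positivity : (0 : ℝ) ≤ 2 * C)
    exact this
  refine ⟨hζ, ?_⟩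
  -- the leak `‖(D_u − ∇)ζ₀‖ ≤ 12√(3|E|)τ_u‖ζ₀‖ ≤ 2τ + ‖Y‖`
  have hleak := norm_covGradL_sub_vacGrad_le L u hτ1 hu ζ₀
  have hleak' : ‖covGradL L u ζ₀ - vacGrad L ζ₀‖ ≤ 2 * τ + ‖Y‖ := by
    refine hleak.trans ?_
    have hM0 : 0 ≤ 12 * Real.sqrt (3 * Fintype.card (Edge 3 L)) * τu := by positivity
    calc 12 * Real.sqrt (3 * Fintype.card (Edge 3 L)) * τu * ‖ζ₀‖ ≤ 12 * Real.sqrt (3 * Fintype.card (Edge 3 L)) * τu * (2 * C * (2 * τ + ‖Y‖)) :=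
          mul_le_mul_of_nonneg_left hζ hM0
      _ = (12 * Real.sqrt (3 * Fintype.card (Edge 3 L)) * τu * C) * 2 * (2 * τ + ‖Y‖) := by ring
      _ ≤ (1 / 2) * 2 * (2 * τ + ‖Y‖) := by gcongr; linarith [norm_nonneg Y, (norm_nonneg _).trans hτX]
      _ = 2 * τ + ‖Y‖ := by ring
  have hstiff : ‖X' - (gaugeModes L).starProjection X'‖ ≤ ‖X‖ + 4 * τ + 4 * ‖Y‖ := by linarith [hb, hleak']
  have hpy := norm_sq_eq_proj_add_sub (gaugeModes L) X'
  rw [hpy]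
  have hτ0 : 0 ≤ τ := (norm_nonneg _).trans hτX
  have h1 : ‖(gaugeModes L).starProjection X'‖ ^ 2 ≤ τ ^ 2 := pow_le_pow_left₀ (norm_nonneg _) hτX' 2
  have h2 : ‖X' - (gaugeModes L).starProjection X'‖ ^ 2 ≤ (‖X‖ + 4 * τ + 4 * ‖Y‖) ^ 2 := pow_le_pow_left₀ (norm_nonneg _) hstiff 2
  linarith

end Summit.QuantumFields.YangMills.Theorems.FemtoTransferGap.TwoLattice.ConstTube

end
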